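import Summits.CriticalPhenomena.CardyFormulaZ2.Theses.CardyIKTransport

/-!
# `Assembly2` (item stmt-CriticalPhenomena-5077) — proved

The assembly item `Assembly2` of route `CardyIKTransport` (registered at route open under the
informal name `CornerLineDescent`, and re-typed by the planner to carry the hypothesis chain of the
route's deciding theorem) reads

`IKLinearTransport → CornerLineDescent → CrudeToCanonical → IKQuarterTurn → SmirnovCardyTri →
AnchorByRigidity → CardyFormulaZ2`,

which is literally the type of the certified deciding theorem
`Summit.CriticalPhenomena.CardyFormulaZ2.Theses.CardyIKTransport.closes` of the route file.
The proof below re-runs the four lines of logic of `closes` against the unfolded definition (so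
that it does not depend on the `@[closes]`-tagged declaration staying byte-identical): obtain the
linear map `K` from `IKLinearTransport`; `AnchorByRigidity` fed with `SmirnovCardyTri`,
`IKQuarterTurn` and the transported Cardy statement forces `K` to be a similarity and yields Cardy
for the isotropic IK gauge in every conformal rectangle; `CornerLineDescent` turns that into Cardy
for the crude bond-ℤ² event on the standard embedding; `CrudeToCanonical` upgrades crude to
canonical, which is `CardyFormulaZ2`.

2026-08-16: the route decl `…Theses.CardyIKTransport.Assembly2` was dropped from the route file by
the duplicate-assembly lint (the item stays recorded as proved by `assembly2_proof @ b3031e5444aa`);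
the chain is therefore spelled out verbatim in `assembly2_chain_proof`, and the old name
`assembly2_proof` survives as a deprecated alias of it.
-/

namespace Summit.CriticalPhenomena.CardyFormulaZ2.Theorems

open Summit.CriticalPhenomena.CardyFormulaZ2.Theses.CardyIKTransport in
/-- The hypothesis chain of the former assembly item `Assembly2` (stmt-CriticalPhenomena-5077) of
route `CardyIKTransport`, spelled out verbatim (the route decl was dropped 2026-08-16), composes to
`CardyFormulaZ2` exactly as in the route's deciding theorem `closes`. [folklore] -/
theorem assembly2_chain_proof :
    IKLinearTransport → CornerLineDescent → CrudeToCanonical → IKQuarterTurn → SmirnovCardyTri →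
      AnchorByRigidity → _root_.CardyFormulaZ2 := by
  intro hlin hdesc hcrude hqt hsm hanchor
  obtain ⟨K, hK⟩ := hlin
  have hA := hanchor hsm
  specialize hA _ K ?qt hK
  · exact hqt
  exact hcrude (hdesc hA.2)

/-- Deprecated name of `assembly2_chain_proof`: it proved the route decl
`Summit.CriticalPhenomena.CardyFormulaZ2.Theses.CardyIKTransport.Assembly2`
(stmt-CriticalPhenomena-5077) by name; that decl was dropped from the route file 2026-08-16 (duplicate-assembly lint), so the
statement is now carried, unfolded, by `assembly2_chain_proof`. [folklore] -/
@[deprecated assembly2_chain_proof (since := "2026-08-16")]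
alias assembly2_proof := assembly2_chain_proof

end Summit.CriticalPhenomena.CardyFormulaZ2.Theorems
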